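import Mathlib
import Summits.PneNP.PneNP.Theses.OneSlice
import Summits.PneNP.PneNP.Theorems.OneSliceSliceTargetSplit
import Summits.PneNP.PneNP.Theorems.OneSliceMonotoneContinuationDefs
import Summits.PneNP.PneNP.Theorems.OneSliceMonotoneContinuationPartial
import Summits.PneNP.PneNP.Theorems.OneSliceMonotoneContinuationSamplerBounds
import Summits.PneNP.PneNP.Theorems.OneSliceMonotoneContinuationMonotoneSeq
import Summits.PneNP.PneNP.Theorems.OneSliceShallowSliceBoundSlices

/-!
# Route OneSlice, crux `MonotoneContinuation` (stmt-PneNP-18471), line `Sketch_ideator1_r1` — bridge infrastructure B3: level densities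

`levelDensity_close`: if a MONOTONE Boolean `g` is `δ`-close in `L¹(G(n,p))` to a real function `u` all of whose level means equal `α`
(the transport has this property, `stub_levelAverage`), then at every level `s₀` whose two binomial tails each carry weight `> δ/δ'`,
the level density of `g` is within `δ'` of `α`. Proof: level densities of a monotone function are non-decreasing
(`ShallowSliceBound.sliceAvg_mono` = local LYM), the binomial-weighted `L¹` distance of the density sequence to `α` is at most
`‖𝟙[g] − u‖_{L¹(G(n,p))}` (`l1_eq_sum_slices` + triangle inequality on each level), and B1 (`monotoneSeq_close`).
Lead prover-line-stmt-PneNP-18471-0, 2026-08-17. Def-free.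
-/

set_option linter.dupNamespace false

namespace Summit.PneNP.PneNP.Theorems.MonotoneContinuation

open Literature.Computability.Complexity hiding supp mem_supp
open Finset hiding slice
open Classical
open Summit.PneNP.PneNP.Theorems (card_slice)
open Summit.PneNP.PneNP.Theorems.ConstantBand.Negative (Edge slice)
open Summit.PneNP.PneNP.Theorems.SliceTargetSplit (ind l1 ind_nonneg ind_le_one l1_eq_sum_slices)
open Summit.PneNP.PneNP.Cruxes.SliceACZero.RussoWindowLadder (wt sliceAvg)
open Summit.PneNP.PneNP.Theorems.ShallowSliceBound (sliceAvg_mono)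

noncomputable section

variable {n : ℕ}

/-- One level: `b_s · |profile g s − α| ≤ p^s (1-p)^{N-s} Σ_{slice s} |𝟙[g] − u|` when the level mean of `u` is `α`. [folklore] -/
theorem binW_mul_abs_profile_sub_le {p : ℝ} (hp0 : 0 ≤ p) (hp1 : p ≤ 1) (g : (Edge n → Bool) → Bool)
    (u : (Edge n → Bool) → ℝ) (α : ℝ) {s : ℕ} (hs : s ≤ n.choose 2)
    (hmean : ∑ x ∈ slice n s, u x = #(slice n s) * α) :
    binW (n.choose 2) p s * |profile g s - α| ≤
      p ^ s * (1 - p) ^ (n.choose 2 - s) * ∑ x ∈ slice n s, |ind g x - u x| := by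
  have hcard : (0 : ℝ) < #(slice n s) := by
    rw [card_slice]; exact_mod_cast Nat.choose_pos hs
  have hdiff : profile g s - α = (∑ x ∈ slice n s, (ind g x - u x)) / #(slice n s) := by
    rw [profile_def, sum_sub_distrib, hmean, sub_div, mul_div_cancel_left₀ _ hcard.ne']
  rw [hdiff, abs_div, Nat.abs_cast, binW_def, card_slice]
  have hw : 0 ≤ p ^ s * (1 - p) ^ (n.choose 2 - s) := mul_nonneg (pow_nonneg hp0 _) (pow_nonneg (sub_nonneg.2 hp1) _)
  have hC : (0 : ℝ) < ((n.choose 2).choose s : ℕ) := by exact_mod_cast Nat.choose_pos hs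
  calc ((n.choose 2).choose s : ℝ) * p ^ s * (1 - p) ^ (n.choose 2 - s) *
        (|∑ x ∈ slice n s, (ind g x - u x)| / ((n.choose 2).choose s : ℕ))
      = p ^ s * (1 - p) ^ (n.choose 2 - s) * |∑ x ∈ slice n s, (ind g x - u x)| := by
        field_simp
    _ ≤ p ^ s * (1 - p) ^ (n.choose 2 - s) * ∑ x ∈ slice n s, |ind g x - u x| :=
        mul_le_mul_of_nonneg_left (abs_sum_le_sum_abs _ _) hw

/-- **B3 · level densities of a monotone function close to a flat-mean profile** (registered sub-goal `levelDensity_close`). [folklore] -/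
theorem levelDensity_close :
  ∀ (n : ℕ) (p : ℝ), 0 ≤ p → p ≤ 1 → ∀ (g : (Edge n → Bool) → Bool), Monotone g →
    ∀ (u : (Edge n → Bool) → ℝ) (α δ δ' : ℝ), 0 < δ' →
    (∀ s : ℕ, s ≤ n.choose 2 → ∑ x ∈ slice n s, u x = #(slice n s) * α) →
    l1 n p (ind g) u ≤ δ →
    ∀ s₀ : ℕ, s₀ ≤ n.choose 2 →
    δ / δ' < ∑ s ∈ (range (n.choose 2 + 1)).filter (fun s => s₀ ≤ s), binW (n.choose 2) p s →
    δ / δ' < ∑ s ∈ (range (n.choose 2 + 1)).filter (fun s => s ≤ s₀), binW (n.choose 2) p s →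
    |profile g s₀ - α| ≤ δ' := by
  intro n p hp0 hp1 g hg u α δ δ' hδ' hmean hclose s₀ hs₀ hup hdown
  -- the density sequence, extended monotonically beyond the cube by its last value
  set N := n.choose 2 with hN
  set d : ℕ → ℝ := fun s => profile g (min s N) with hd
  have hdmono : ∀ s t, s ≤ t → d s ≤ d t := fun s t hst =>
    profile_mono hg (min_le_min_right N hst) (min_le_right _ _)
  have hds₀ : d s₀ = profile g s₀ := by simp only [hd, min_eq_left hs₀]
  -- weighted closeness of the density sequence
  have hsum : ∑ s ∈ range (N + 1), binW N p s * |d s - α| ≤ δ := by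
    calc ∑ s ∈ range (N + 1), binW N p s * |d s - α|
        ≤ ∑ s ∈ range (N + 1), p ^ s * (1 - p) ^ (N - s) * ∑ x ∈ slice n s, |ind g x - u x| := by
          refine sum_le_sum fun s hs => ?_
          have hsN : s ≤ N := Nat.lt_succ_iff.1 (mem_range.1 hs)
          have : d s = profile g s := by simp only [hd, min_eq_left hsN]
          rw [this]
          exact binW_mul_abs_profile_sub_le hp0 hp1 g u α hsN (hmean s hsN)
      _ = l1 n p (ind g) u := (l1_eq_sum_slices p (ind g) u).symm
      _ ≤ δ := hclose
  rw [← hds₀]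
  exact monotoneSeq_close d (binW N p) α δ δ' (range (N + 1)) hδ' hdmono (fun s => binW_nonneg hp0 hp1 s) hsum s₀ hup hdown

end

end Summit.PneNP.PneNP.Theorems.MonotoneContinuation
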